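import Mathlib
import HarnessLib
import Summits.ResolutionOfSingularities.ResolutionOfSingularities.Theorems.HomologicalConductorSurfaceTerminationCaptureDescent
import Summits.ResolutionOfSingularities.ResolutionOfSingularities.Theorems.HomologicalConductorSurfaceTerminationGenusFinite
import Summits.ResolutionOfSingularities.ResolutionOfSingularities.Theorems.HomologicalConductorSurfaceTerminationReductionDefs

/-!
# Kill test `SurfaceTermination` (stmt-ResolutionOfSingularities-16488), line `genus-descent`: CAPTURE AT THE
# NON-RATIONAL STAGES replaces the research stub — doors BY NAME, modulo the line's six facts

Route `ResolutionOfSingularities/HomologicalConductor`, support item `SurfaceTermination`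
(stmt-ResolutionOfSingularities-16488), registered skeleton `line-genus-descent-r8` (c2da4ae6bde8d476; stubs
`stub_publishedSurfaceFacts` = the six-fact conjunction, `stub_initialPairOfConstantGenus` = the research residue
(D-s)^{p_g ≥ 1} in (E)-form).  OURS (hand leafhand-res-homologicalconduct-20, 2026-08-31); nothing here is a
statement of the manuscript under review (Hironaka 2017); AI-written, weaker than expert review.

With the fact-free E-descent `CaptureDescent.termination_of_capture` (p830771) the kill test needs, beyond the
six facts, only CAPTURE AT NON-RATIONAL SINGULAR STAGES:

  (CAP¬rat)  for every tower of the route's datum and every stage `T_(m+1)` that is singular and NOT a rational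
  singularity, `ca(T_(m+1))·S` is principal for every regular local `k`-subalgebra `S ⊇ T_(m+1)` of `K`,
  essentially of finite type over `k` and dominating `T_(m+1)`.

Indeed a singular stage is a two-dimensional normal local domain essentially of finite type, so it has a
resolution by Cossart–Jannsen–Saito (`GenusDescent.exists_isResolution_Spec_of_cjsGeneral`); at RATIONAL singular
stages capture is THEOREM A (`RationalDescent.isPrincipal_map_ca_of_isRegularLocalRing_dominating`, Lipman (1.2),
(4.1), (12.1)); at the others it is (CAP¬rat).  Hence:

* `surfaceTermination_of_facts_of_nonrationalCapture` : six facts → (CAP¬rat) → `SurfaceTermination` BY NAME;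
* `primeDivisorSurfaceTermination_of_facts_of_nonrationalCapture` : the same onto the line's reduction target
  `SurfaceTermination.Reduction.PrimeDivisorSurfaceTermination` (D-s);
* `initialPairOfConstantGenus_of_nonrationalCapture` : (CAP¬rat) → the registered residue
  `Sig.stub_initialPairOfConstantGenus` with `Sig.stub_publishedSurfaceFacts` SPELLED as its six-fact conjunction
  (the skeleton's text verbatim otherwise) — an eternal positive constant genus along a prime divisor contradicts
  the regular stage that (CAP¬rat) produces, so the initial pair exists vacuously.  So (CAP¬rat) is at least as
  strong as the line's open stub and can stand in for it in `SurfaceTermination_of`.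

HONEST CAVEAT (as in `…CaptureDescent`): (CAP¬rat) is SUFFICIENT, not equivalent — it fails at a non-rational stage
whose `ca` has base points on the minimal resolution even when the tower goes on to terminate; the equivalent
form asks capture only on ONE resolution of one singular stage (`…CaptureDescentResolution`).  For CONES over
smooth projectively normal curves the first step is decided by the lowest-degree piece `V` of `ca`: base-point
free `V` ⇒ the normalised `ca`-blow-up is the (regular) blow-up of the vertex; `dim V ≥ 2` ⇒ the curve survives
and the new singular points are sandwiched (rational); `dim V = 1` ⇒ the curve is contracted again (the only
non-terminating pattern) — see the hand's memo HAND20-CAPTURE-DESCENT.md on the item.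

No new definitions; named-fact hypotheses = the line's six facts, explicit.

References: V. Cossart, U. Jannsen, S. Saito (2020), Thm. 1.2 [`CossartJannsenSaito2020`]; J. Lipman, Publ. Math.
IHÉS 36 (1969), (1.1), (1.2), (4.1), (12.1) [`Lipman1969`]; U. Görtz, T. Wedhorn, AG II (2023), Thm. 24.44
[`GortzWedhorn2023`]; O. Zariski, P. Samuel, *Commutative Algebra* II (1960), Ch. VI §14, §17 [`ZariskiSamuel1960`].
-/

noncomputable section

-- single-problem summit: the doubled namespace component `ResolutionOfSingularities` is forced
set_option linter.dupNamespace false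

namespace Summit.ResolutionOfSingularities.ResolutionOfSingularities.Theorems.SurfaceTermination.CaptureDescent

open CategoryTheory AlgebraicGeometry IsLocalRing Polynomial
open Literature.AlgebraicGeometry.Resolution Literature.AlgebraicGeometry.Morphisms
open Literature.RingTheory.CohomologyAnnihilator (cohomologyAnnihilator)
open Summit.ResolutionOfSingularities.ResolutionOfSingularities.Theses.HomologicalConductor (SurfaceTermination)
open Summit.ResolutionOfSingularities.ResolutionOfSingularities.Theorems.NoZeno.Birth
open Summit.ResolutionOfSingularities.ResolutionOfSingularities.Theorems.NoZeno.SandwichCluster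
open Summit.ResolutionOfSingularities.ResolutionOfSingularities.Theorems.SurfaceTermination.Descent
open Summit.ResolutionOfSingularities.ResolutionOfSingularities.Theorems.SurfaceTermination.GenusDescent
open Summit.ResolutionOfSingularities.ResolutionOfSingularities.Theorems.SurfaceTermination.Reduction

/-! ## The kill test from the six facts and capture at the non-rational stages -/

/-- **Six facts + (CAP¬rat) ⇒ `SurfaceTermination` (stmt-ResolutionOfSingularities-16488) BY NAME.**  For every
tower: if `T_1` is regular we are done; otherwise `T_1` is a singular two-dimensional normal local domain
essentially of finite type, Cossart–Jannsen–Saito resolves it, and the fact-free E-descent `termination_of_capture`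
runs from `m₁ = 0`, capture being THEOREM A at the rational singular stages and the hypothesis at the others.
[cite: CossartJannsenSaito2020, Thm. 1.2] [cite: Lipman1969, Proposition (1.2) and Theorem (4.1) (pp. 199, 204)] -/
theorem surfaceTermination_of_facts_of_nonrationalCapture
    (hF : (CossartJannsenSaito2020General.{0} ∧ Lipman1969_1_2.{0} ∧ Lipman1969_4_1.{0} ∧
      Lipman1969_12_1_i.{0} ∧ Lipman1969_12_1_ii.{0} ∧ GortzWedhorn2023_24_44_H2.{0}))
    (hCAP : ∀ (k K : Type) [Field k] [Field K] [Algebra k K] (O : ValuationSubring K) (A : Subalgebra k K),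
      (∀ c : k, algebraMap k K c ∈ O) → A.FG → IsFractionRing ↥A K → A.toSubring ≤ O.toSubring →
      ringKrullDim ↥A = 2 → ∀ m : ℕ, ¬ IsRegularLocalRing ↥(tower O A (m + 1)) →
      ¬ HasRationalSingularity ↥(tower O A (m + 1)) →
      ∀ (S : Subalgebra k K) (hTS : tower O A (m + 1) ≤ S),
        (∀ t ∈ tower O A (m + 1), t⁻¹ ∈ S → t⁻¹ ∈ tower O A (m + 1)) →
        IsRegularLocalRing ↥S → Algebra.EssFiniteType k ↥S →
        (Ideal.map (Subalgebra.inclusion hTS).toRingHom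
          (cohomologyAnnihilator ↥(tower O A (m + 1)))).IsPrincipal) :
    SurfaceTermination := by
  intro p _hp k K _ _ _ _ O A hk hA hfr hAO hdimA ca loc chart nrm tower'
  show ∃ m : ℕ, IsRegularLocalRing ↥(NoZeno.Birth.tower O A m)
  by_cases hreg₁ : IsRegularLocalRing ↥(NoZeno.Birth.tower O A (0 + 1))
  · exact ⟨_, hreg₁⟩
  haveI := hfr
  have htr : Algebra.trdeg k K = 2 := trdeg_eq_two_of_ringKrullDim A hA hfr hdimA
  -- the singular stage `T_1`: noetherian, normal, essentially of finite type, of dimension two; CJS resolves it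
  haveI : IsNoetherianRing ↥(NoZeno.Birth.tower O A (0 + 1)) := stub_towerNoetherian k K O A hk hA hfr hAO _
  haveI : IsIntegrallyClosed ↥(NoZeno.Birth.tower O A (0 + 1)) :=
    d2rc_isIntegrallyClosed_tower_succ O A hk hA hfr hAO 0
  haveI : IsLocalRing ↥(NoZeno.Birth.tower O A (0 + 1)) := by
    obtain ⟨B, hBO, hTB⟩ := exists_tower_eq_loc O A hk hAO (0 + 1)
    rw [hTB, loc_eq_locAt]; exact SyzygyFlattening.isLocalRing_locAt O B hBO
  have hET : Algebra.EssFiniteType k ↥(NoZeno.Birth.tower O A (0 + 1)) :=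
    (tn_tower_invariant O A hk hA hfr hAO (0 + 1)).2.2
  have hdimT : ringKrullDim ↥(NoZeno.Birth.tower O A (0 + 1)) = 2 :=
    ringKrullDim_tower_eq_two_of_not_isRegularLocalRing O A hk hA hfr hAO htr 0 hreg₁
  obtain ⟨X, π, hπ⟩ :=
    exists_isResolution_Spec_of_cjsGeneral hF.1 k ↥(NoZeno.Birth.tower O A (0 + 1)) hET hdimT.le
  refine termination_of_capture O A hk hA hfr hAO hdimA 0 hreg₁ ⟨X, π, hπ⟩ ?_
  intro i hi hsingi S hTS hdomS hSreg hSeft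
  obtain ⟨d, rfl⟩ : ∃ d, i = d + 1 := ⟨i - 1, by omega⟩
  by_cases hrat : HasRationalSingularity ↥(NoZeno.Birth.tower O A (d + 1))
  · exact RationalDescent.isPrincipal_map_ca_of_isRegularLocalRing_dominating hF O A hk hA hfr hAO htr d hsingi
      hrat S hTS hdomS hSreg hSeft
  · exact hCAP k K O A hk hA hfr hAO hdimA d hsingi hrat S hTS hdomS hSreg hSeft

/-- **Six facts + (CAP¬rat) ⇒ (D-s) `PrimeDivisorSurfaceTermination`** (the reduction target of the line,
`SurfaceTermination.Reduction.PrimeDivisorSurfaceTermination`: the kill test along prime divisors) — the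
prime-divisor binders are simply not used. [cite: ZariskiSamuel1960, Ch. VI §14, Thm. 31] -/
theorem primeDivisorSurfaceTermination_of_facts_of_nonrationalCapture
    (hF : (CossartJannsenSaito2020General.{0} ∧ Lipman1969_1_2.{0} ∧ Lipman1969_4_1.{0} ∧
      Lipman1969_12_1_i.{0} ∧ Lipman1969_12_1_ii.{0} ∧ GortzWedhorn2023_24_44_H2.{0}))
    (hCAP : ∀ (k K : Type) [Field k] [Field K] [Algebra k K] (O : ValuationSubring K) (A : Subalgebra k K),
      (∀ c : k, algebraMap k K c ∈ O) → A.FG → IsFractionRing ↥A K → A.toSubring ≤ O.toSubring →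
      ringKrullDim ↥A = 2 → ∀ m : ℕ, ¬ IsRegularLocalRing ↥(tower O A (m + 1)) →
      ¬ HasRationalSingularity ↥(tower O A (m + 1)) →
      ∀ (S : Subalgebra k K) (hTS : tower O A (m + 1) ≤ S),
        (∀ t ∈ tower O A (m + 1), t⁻¹ ∈ S → t⁻¹ ∈ tower O A (m + 1)) →
        IsRegularLocalRing ↥S → Algebra.EssFiniteType k ↥S →
        (Ideal.map (Subalgebra.inclusion hTS).toRingHom
          (cohomologyAnnihilator ↥(tower O A (m + 1)))).IsPrincipal) :
    PrimeDivisorSurfaceTermination := by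
  intro p hp k K _ _ _ _ O A hk hA hfr hAO hdimA _hOtop _hdvr _hres ca loc chart nrm tower'
  show ∃ m : ℕ, IsRegularLocalRing ↥(NoZeno.Birth.tower O A m)
  exact surfaceTermination_of_facts_of_nonrationalCapture hF hCAP p hp k K O A hk hA hfr hAO hdimA

/-! ## (CAP¬rat) is at least as strong as the registered residue of the line -/

/-- **(CAP¬rat) ⇒ the registered residue `stub_initialPairOfConstantGenus` of line `genus-descent`** (its
statement `Sig.stub_initialPairOfConstantGenus` VERBATIM, with the binder `Sig.stub_publishedSurfaceFacts` spelled
as the six-fact conjunction): along a prime divisor `O`, an eternal positive constant geometric genus `g + 1`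
from stage `m + 1` on is contradictory — (CAP¬rat) and the facts give a regular stage `T_(m'')`
(`surfaceTermination_of_facts_of_nonrationalCapture`), regular stages persist
(`Descent.isRegularLocalRing_tower_of_le`), so `T_(m''+m+1)` is regular, hence rational
(`hasRationalSingularity_of_isRegularLocalRing`), hence of genus `≤ 0 ≤ g`
(`hasGeometricGenusLE_zero_iff`, `hasGeometricGenusLE_mono`) — against the hypothesis at `m' = m'' + m`; so the
initial pair exists vacuously. [cite: Lipman1969, Definition (1.1) (p. 199)] -/
theorem initialPairOfConstantGenus_of_nonrationalCapture
    (hCAP : ∀ (k K : Type) [Field k] [Field K] [Algebra k K] (O : ValuationSubring K) (A : Subalgebra k K),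
      (∀ c : k, algebraMap k K c ∈ O) → A.FG → IsFractionRing ↥A K → A.toSubring ≤ O.toSubring →
      ringKrullDim ↥A = 2 → ∀ m : ℕ, ¬ IsRegularLocalRing ↥(tower O A (m + 1)) →
      ¬ HasRationalSingularity ↥(tower O A (m + 1)) →
      ∀ (S : Subalgebra k K) (hTS : tower O A (m + 1) ≤ S),
        (∀ t ∈ tower O A (m + 1), t⁻¹ ∈ S → t⁻¹ ∈ tower O A (m + 1)) →
        IsRegularLocalRing ↥S → Algebra.EssFiniteType k ↥S →
        (Ideal.map (Subalgebra.inclusion hTS).toRingHom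
          (cohomologyAnnihilator ↥(tower O A (m + 1)))).IsPrincipal) :
    (CossartJannsenSaito2020General.{0} ∧ Lipman1969_1_2.{0} ∧ Lipman1969_4_1.{0} ∧
      Lipman1969_12_1_i.{0} ∧ Lipman1969_12_1_ii.{0} ∧ GortzWedhorn2023_24_44_H2.{0}) →
    ∀ p : ℕ, p.Prime → ∀ (k K : Type) [Field k] [CharP k p] [Field K] [Algebra k K]
    (O : ValuationSubring K) (A : Subalgebra k K) (hk : ∀ c : k, algebraMap k K c ∈ O), A.FG →
    IsFractionRing ↥A K → A.toSubring ≤ O.toSubring → ringKrullDim ↥A = 2 →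
    O ≠ ⊤ → IsDiscreteValuationRing ↥O → residueTrdeg k O hk + 1 = Algebra.trdeg k K →
    ∀ g m : ℕ, (∀ m' : ℕ, m ≤ m' →
      HasGeometricGenusLE ↥(tower O A (m' + 1)) (g + 1) ∧ ¬ HasGeometricGenusLE ↥(tower O A (m' + 1)) g) →
      ∃ (m' : ℕ) (g₀ g₁ : K), g₀ ∈ ca (tower O A m') ∧ g₁ ∈ ca (tower O A m') ∧ g₀ ≠ 0 ∧
        (∀ c ∈ ca (tower O A m'), c * g₀⁻¹ ∈ O) ∧
        ∀ f : k[X], f ≠ 0 → ¬ O.valuation (aeval (g₁ * g₀⁻¹) f) < 1 := by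
  intro hF p hp k K _ _ _ _ O A hk hA hfr hAO hdim _hOtop _hdvr _hres g m h
  exfalso
  have hT : ∃ m'' : ℕ, IsRegularLocalRing ↥(tower O A m'') :=
    surfaceTermination_of_facts_of_nonrationalCapture hF hCAP p hp k K O A hk hA hfr hAO hdim
  obtain ⟨m'', hreg⟩ := hT
  have hreg' : IsRegularLocalRing ↥(tower O A (m'' + m + 1)) :=
    isRegularLocalRing_tower_of_le O A hk hfr hAO (by omega) hreg
  have hrat : HasRationalSingularity ↥(tower O A (m'' + m + 1)) := by
    haveI := hreg'
    exact hasRationalSingularity_of_isRegularLocalRing _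
  exact (h (m'' + m) (Nat.le_add_left m m'')).2
    (hasGeometricGenusLE_mono (Nat.zero_le g) ((hasGeometricGenusLE_zero_iff _).mpr hrat))

end Summit.ResolutionOfSingularities.ResolutionOfSingularities.Theorems.SurfaceTermination.CaptureDescent

end
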